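import Literature.NumberTheory.ComplexMultiplication.ShimuraReciprocityExtendedRingClassProofs
import Literature.NumberTheory.EllipticCurves.XZeroThirtyTwoEtaCoordinates
import Literature.NumberTheory.EllipticCurves.TianYuanZhang2017.CMPointSevenBlockValueDisplaysProofs
import Literature.NumberTheory.EllipticCurves.TianYuanZhang2017.GenusPointDescentDisplays
import Literature.NumberTheory.EllipticCurves.HeegnerPointsImaginaryQuadraticProofs
import Literature.NumberTheory.QuadraticFields.IntegralBasisConjugation
import Literature.NumberTheory.QuadraticFields.DiscriminantOfSqrt
import HarnessLib

/-!
# Route `PrintCf2`, crux stmt-BirchSwinnertonDyer-20509 `RamifiedOffTYZOfFacts`, THEOREM A's step (R0) in the kernel: the CM-field data of a block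
# `n ≡ 7 (mod 8)` in Cox's convention — `K_n = ℚ(√−n)` imaginary quadratic, `ι : K_n → ℂ`, `θ = a·τ_{Q_{n,δ}} = (−δ + √−n)/2` with
# `𝒪_{K_n} = ℤ + ℤθ`, and «(S4) ⟹ `ȷ(x₀) = s(τ_{n,δ})²`»
# (cell `bsd-print-cf2`, LEAD cruxlead-20509 g32, line `offtyz-v7`, lineage cycle 33; `def`-free; the last § is conditional on the display `x032_φ_eq_etaQuotient`)

HONEST FRAMING (`--supports stmt-BirchSwinnertonDyer-20509`; theorems only, no `sorry`, no new named fact).  BSD is not proved by any of this; no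
class is closed by this file; item 23431 (C⁺) and crux 20509 stay OPEN.  This is the glue (R0) of THEOREM A's kernel road (memo
`Cruxes/RamifiedOffTYZOfFacts/Lines/offtyz_v7_TheoremARoad.md` §3): every hypothesis of `TheoremAReciprocity.artinSymbol_principal_apply_sqrtX` (R1)
about the field `K`, the embedding `ι`, the generator `θ` and the form `(a, b, c)` is DISCHARGED for `K = K_n = TianYuanZhang2017.GenusField n`
(`= ℚ[X]/(X² + n)`) and TYZ's level-`32` Heegner form `Q_{n,δ} = sevenBlockForm n δ = ((n+δ²)/4, δ, 1)`, `128 ∣ n + δ²`, `n ≡ 7 (mod 8)` square-free: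

* `isImaginaryQuadratic_genusField` — `K_n` is imaginary quadratic (`n ≥ 1`);
* `exists_ringHom_genusField_complex` — an embedding `ι : K_n → ℂ` with `ι(√−n) = i√n`;
* `discr_genusField` — `d_{K_n} = −n` for `n ≡ 3 (mod 4)` square-free, `n > 1` (tree: `discr_eq_of_sq_eq_intCast_of_squarefree_natAbs`);
* ★ `exists_theta_genusField` — for `n ≡ 7 (mod 8)` square-free and `δ` odd there is `θ ∈ 𝓞 K_n` with `θ = (−δ + √−n)/2` and **`𝓞 K_n = ℤ + ℤθ`**
  (`∀ z : 𝓞 K, ∃ A B : ℤ, z = A + Bθ` — the hypothesis `hgen` of Cox's reciprocity display; from the tree's integral basis `TauData` of a quadratic field);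
* `map_theta_eq_mul_heegnerTau` — `ι θ = a · τ_{Q_{n,δ}}` (ty2 g51: `sevenBlockForm_fst_mul_coe_heegnerTau`);
* `sevenBlockForm_hyps` — `0 < a`, `b² − 4ac < 0`, `gcd(a, b, c) = 1`, `32 ∣ a` for `(a,b,c) = Q_{n,δ}`;
* `exists_ringHom_rayClassField_complex` — an embedding `e : K^{(32)} → ℂ` over `ι` (`IsAlgClosed.lift`);
* ★ `SevenBlockCMValue.exists_map_x_eq_etaQuotient_rS_sq` — **(S4) + Yang's coordinates ⟹ `ȷ(x₀) = s(τ_{n,δ})²`, `ȷ(y₀) = ±Y(τ_{n,δ})`**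
  (`x032_φ_eq_etaQuotient` + `etaQuotient_rX_eq_sq`): the abstract `x₀` of a realisation carrying (S4) IS the CM value of `s²`.

So after this file the CM side of THEOREM A reads: `ȷ x₀ = (e s₀)²` with `s₀ ∈ K_n^{(32)}` on which the Artin symbols of principal ideals act by
the signs `χ₈(n′A)` (R1).  Remaining (memo §3): (R2) order-two arithmetic, (R3) evenness, (R4) distinct conjugates, (R6) orbit = norm + transport.

References: [cite: TianYuanZhang2017, §3.1 (p0010 L47–L52, L85–L89)]; [cite: Cox2013, §15.C–15.D (θ = aτ₀, 𝒪 = [1, aτ₀])]; [cite: Marcus2018, Ch. 2 Thm. 1];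
[cite: Yang2006DefiningEquations, §4.1 Table row N = 32]; tree: p810361/…ValueDisplaysProofs, p811081, p811633 (R1), `QuadraticFields/IntegralBasisConjugation.lean`.
-/

noncomputable section

open scoped Classical
open UpperHalfPlane hiding I
open NumberField Complex Polynomial

namespace Summit.BirchSwinnertonDyer.PrintCf2.TheoremAField

open Literature.NumberTheory.EllipticCurves (heegnerTau IsImaginaryQuadratic)
open Literature.NumberTheory.EllipticCurves.TianYuanZhang2017
open Literature.NumberTheory.EllipticCurves.ModularForms
open Literature.NumberTheory.QuadraticFields.Quadratic
open Literature.NumberTheory.NumberFields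

/-! ## §1 `K_n = ℚ(√−n)` is imaginary quadratic; an embedding into `ℂ` -/

/-- `K_n = GenusField n` (`n ≥ 1`) is an imaginary quadratic field. [cite: TianYuanZhang2017, §1 (p0002 L78–L82)] -/
theorem isImaginaryQuadratic_genusField {n : ℕ} (hn : 1 ≤ n) : IsImaginaryQuadratic (GenusField n) := by
  have hc : (-(n : ℚ)) < 0 := by
    have : (0 : ℚ) < n := by exact_mod_cast hn
    linarith
  refine IsImaginaryQuadratic.of_sq_eq (finrank_genusField n) (θ := AdjoinRoot.root (genusFieldPoly n)) (c := -(n : ℚ)) ?_ hc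
  rw [root_genusField_sq hn, map_neg]
  simp

/-- An embedding `ι : K_n → ℂ` with `ι(√−n) = i·√n`. [cite: TianYuanZhang2017, §3.1 (p0010 L47–L50)] -/
theorem exists_ringHom_genusField_complex (n : ℕ) (hn : 1 ≤ n) :
    ∃ ι : GenusField n →+* ℂ, ι (AdjoinRoot.root (genusFieldPoly n)) = I * ((√(n : ℝ) : ℝ) : ℂ) := by
  have hev : (genusFieldPoly n).eval₂ (algebraMap ℚ ℂ) (I * ((√(n : ℝ) : ℝ) : ℂ)) = 0 := by
    rw [genusFieldPoly, eval₂_add, eval₂_pow, eval₂_X, eval₂_C, max_eq_left hn, map_natCast, mul_pow, I_sq,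
      ← ofReal_pow, Real.sq_sqrt (Nat.cast_nonneg n)]
    push_cast; ring
  exact ⟨AdjoinRoot.lift (algebraMap ℚ ℂ) _ hev, AdjoinRoot.lift_root hev⟩

/-- `d_{K_n} = −n` for square-free `n ≡ 3 (mod 4)`, `n > 1`. [cite: Marcus2018, Ch. 2 Thm. 1] -/
theorem discr_genusField {n : ℕ} (hn1 : 1 < n) (hn4 : n % 4 = 3) (hsq : Squarefree n) :
    NumberField.discr (GenusField n) = -(n : ℤ) := by
  refine discr_eq_of_sq_eq_intCast_of_squarefree_natAbs (finrank_genusField n) (θ := AdjoinRoot.root (genusFieldPoly n))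
    (D := -(n : ℤ)) ?_ (by omega) (by simpa using hsq) (by omega)
  rw [root_genusField_sq hn1.le]; push_cast; ring

/-! ## §2 The generator `θ = (−δ + √−n)/2` and `𝓞 K_n = ℤ + ℤθ` -/

/-- ★ **`𝓞_{K_n} = ℤ + ℤθ` with `θ = (−δ + √−n)/2`** for square-free `n ≡ 7 (mod 8)` and odd `δ`.  From the tree's integral basis `(1, τ)`,
`τ = (ε + s)/2`, `s² = d_K = −n` (so `ε = 1`, `s = ±√−n`): `θ = τ − (1+δ)/2` or `θ = −τ + (1−δ)/2`.
[cite: Marcus2018, Ch. 2 Thm. 1] [cite: Cox2013, §15.D (𝒪 = [1, aτ₀])] -/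
theorem exists_theta_genusField {n : ℕ} (hn7 : n % 8 = 7) (hsq : Squarefree n) {δ : ℤ} (hδ : Odd δ) :
    ∃ θ : 𝓞 (GenusField n), ((θ : GenusField n)) = (-(δ : GenusField n) + AdjoinRoot.root (genusFieldPoly n)) / 2 ∧
      ∀ z : 𝓞 (GenusField n), ∃ A B : ℤ, (z : GenusField n) = A + B * (θ : GenusField n) := by
  have hn1 : 1 < n := by omega
  have h2 := finrank_genusField n
  obtain ⟨T⟩ := nonempty_tauData (K := GenusField n) h2
  have hdisc : NumberField.discr (GenusField n) = -(n : ℤ) := discr_genusField hn1 (by omega) hsq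
  -- `ε = 1`
  have hε : T.ε = 1 := by
    have h := T.discr_eq
    rw [hdisc] at h
    rcases T.ε_eq with h0 | h1
    · exfalso; omega
    · exact h1
  -- `s = ±√−n`
  have hs2 : ((T.s : 𝓞 (GenusField n)) : GenusField n) ^ 2 = (AdjoinRoot.root (genusFieldPoly n)) ^ 2 := by
    rw [T.sq_s, hdisc, root_genusField_sq hn1.le]; push_cast; ring
  have hs := sq_eq_sq_iff_eq_or_eq_neg.mp hs2
  obtain ⟨k, hk⟩ := hδ
  have hδK : (δ : GenusField n) = 2 * k + 1 := by exact_mod_cast hk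
  rcases hs with hs | hs
  · -- `τ = (1 + √−n)/2`, `θ := τ − (1+δ)/2 = τ − (k+1)`
    refine ⟨T.τ - ((k + 1 : ℤ) : 𝓞 (GenusField n)), ?_, fun z => ?_⟩
    · have hτ := T.coe_τ
      rw [hε, hs] at hτ
      have e : (((T.τ - ((k + 1 : ℤ) : 𝓞 (GenusField n))) : 𝓞 (GenusField n)) : GenusField n) =
          (T.τ : GenusField n) - ((k + 1 : ℤ) : GenusField n) := by push_cast; rfl
      rw [e, hτ, hδK]; push_cast; ring
    · obtain ⟨u, v, huv⟩ := T.exists_int_coords_coe z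
      rw [hε, hs] at huv
      refine ⟨u + v * (k + 1), v, ?_⟩
      have e : (((T.τ - ((k + 1 : ℤ) : 𝓞 (GenusField n))) : 𝓞 (GenusField n)) : GenusField n) =
          (T.τ : GenusField n) - ((k + 1 : ℤ) : GenusField n) := by push_cast; rfl
      have hτ := T.coe_τ
      rw [hε, hs] at hτ
      rw [huv, e, hτ]; push_cast; ring
  · -- `τ = (1 − √−n)/2`, `θ := −τ + (1−δ)/2 = −τ − k`
    refine ⟨-T.τ - ((k : ℤ) : 𝓞 (GenusField n)), ?_, fun z => ?_⟩
    · have hτ := T.coe_τ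
      rw [hε, hs] at hτ
      have e : (((-T.τ - ((k : ℤ) : 𝓞 (GenusField n))) : 𝓞 (GenusField n)) : GenusField n) =
          -(T.τ : GenusField n) - ((k : ℤ) : GenusField n) := by simp
      rw [e, hτ, hδK]; push_cast; ring
    · obtain ⟨u, v, huv⟩ := T.exists_int_coords_coe z
      rw [hε, hs] at huv
      refine ⟨u - v * k, -v, ?_⟩
      have e : (((-T.τ - ((k : ℤ) : 𝓞 (GenusField n))) : 𝓞 (GenusField n)) : GenusField n) =
          -(T.τ : GenusField n) - ((k : ℤ) : GenusField n) := by simp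
      have hτ := T.coe_τ
      rw [hε, hs] at hτ
      rw [huv, e, hτ]; push_cast; ring

/-- **`ι θ = a · τ_{Q_{n,δ}}`**: under `ι(√−n) = i√n`, `θ = (−δ + √−n)/2` goes to `(−δ + i√n)/2 = a·τ_{Q_{n,δ}}` (`a = (n+δ²)/4`).
[cite: TianYuanZhang2017, §3.1 (p0010 L85–L88)] [cite: Cox2013, Thm. 15.17 (θ = aτ₀)] -/
theorem map_theta_eq_mul_heegnerTau {n : ℕ} (hn : 0 < n) {δ : ℤ} (h128 : (128 : ℤ) ∣ (n : ℤ) + δ ^ 2)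
    {ι : GenusField n →+* ℂ} (hι : ι (AdjoinRoot.root (genusFieldPoly n)) = I * ((√(n : ℝ) : ℝ) : ℂ))
    {θ : 𝓞 (GenusField n)} (hθ : ((θ : GenusField n)) = (-(δ : GenusField n) + AdjoinRoot.root (genusFieldPoly n)) / 2) :
    ι (θ : GenusField n) = ((sevenBlockForm n δ).1 : ℂ) * ((heegnerTau (sevenBlockForm n δ) : ℍ) : ℂ) := by
  rw [sevenBlockForm_fst_mul_coe_heegnerTau hn h128, hθ, map_div₀, map_add, map_neg, map_intCast, hι, map_ofNat]

/-- The standing hypotheses on `(a, b, c) = Q_{n,δ}`: `0 < a`, `b² − 4ac = −n < 0`, `gcd(gcd(a,b),c) = 1` (`c = 1`), `32 ∣ a`.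
[cite: TianYuanZhang2017, §3.1 (p0010 L47–L52)] [cite: Gross1984, §I.1] -/
theorem sevenBlockForm_hyps {n : ℕ} (hn : 0 < n) {δ : ℤ} (h128 : (128 : ℤ) ∣ (n : ℤ) + δ ^ 2) :
    0 < (sevenBlockForm n δ).1 ∧
      (sevenBlockForm n δ).2.1 ^ 2 - 4 * (sevenBlockForm n δ).1 * (sevenBlockForm n δ).2.2 < 0 ∧
      Int.gcd (Int.gcd (sevenBlockForm n δ).1 (sevenBlockForm n δ).2.1) (sevenBlockForm n δ).2.2 = 1 ∧
      (32 : ℤ) ∣ (sevenBlockForm n δ).1 := by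
  have h4 : (4 : ℤ) ∣ (n : ℤ) + δ ^ 2 := (show (4 : ℤ) ∣ 128 by norm_num).trans h128
  refine ⟨sevenBlockForm_fst_pos hn h128, ?_, ?_, dvd_sevenBlockForm_fst h128⟩
  · rw [sevenBlockForm_discr h4]; omega
  · rw [(sevenBlockForm_apply n δ).2.2, Int.gcd_one_right]

/-! ## §3 An embedding of the ray class field `K_n^{(32)}` over `ι` -/

/-- An embedding `e : K^{(𝔪)} → ℂ` extending `ι : K → ℂ` (`ℂ` is algebraically closed, `K^{(𝔪)}/K` is algebraic). [folklore] -/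
theorem exists_ringHom_rayClassField_complex (K : Type) [Field K] [NumberField K] (ι : K →+* ℂ) (𝔪 : Ideal (𝓞 K)) :
    ∃ e : rayClassField K 𝔪 →+* ℂ, ∀ k : K, e (algebraMap K (rayClassField K 𝔪) k) = ι k := by
  letI : Algebra K ℂ := ι.toAlgebra
  let f : rayClassField K 𝔪 →ₐ[K] ℂ := IsAlgClosed.lift
  exact ⟨f.toRingHom, fun k => f.commutes k⟩

/-! ## §4 (S4) + Yang's coordinates: the realisation's `x₀` is the CM value `s(τ_{n,δ})²` -/

/-- ★ **(S4) ⟹ `ȷ(x₀) = s(τ_{d,δ})²` and `ȷ(y₀) = ±Y(τ_{d,δ})`**, granted the display `x032_φ_eq_etaQuotient` (Yang 2006: `x∘i₀ = x_η = s²`,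
`y∘i₀ = ±y_η`). [cite: TianYuanZhang2017, §3.1 (p0010 L39, L85–L89)] [cite: Yang2006DefiningEquations, §4.1 Table row N = 32] -/
theorem _root_.Literature.NumberTheory.EllipticCurves.TianYuanZhang2017.SevenBlockCMValue.exists_map_x_eq_etaQuotient_rS_sq
    (hP : x032_φ_eq_etaQuotient) {M : Type} [Field M] [CharZero M] {x₀ y₀ : M}
    {h₀ : (curveA.baseChange M).toAffine.Nonsingular x₀ y₀} {d : ℕ} (h : SevenBlockCMValue (.some x₀ y₀ h₀) d) :
    ∃ (j : M →+* ℂ) (δ : ℤ), (128 : ℤ) ∣ (d : ℤ) + δ ^ 2 ∧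
      j x₀ = etaQuotient 32 rS (heegnerTau (sevenBlockForm d δ)) ^ 2 ∧
      (j y₀ = etaQuotient 32 rY (heegnerTau (sevenBlockForm d δ)) ∨ j y₀ = -etaQuotient 32 rY (heegnerTau (sevenBlockForm d δ))) := by
  obtain ⟨j, δ, Dt, hj, hδ, hdeg, hz⟩ := h.exists_map_eq_some
  obtain ⟨yτ, hτ, hφ, hy⟩ := hP Dt hdeg (heegnerTau (sevenBlockForm d δ))
  rw [hφ] at hz
  have hx : etaQuotient 32 rX (heegnerTau (sevenBlockForm d δ)) = j x₀ ∧ yτ = j y₀ := by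
    simpa using (WeierstrassCurve.Affine.Point.some.injEq _ _ _ _ _ _).mp hz
  refine ⟨j, δ, hδ, ?_, ?_⟩
  · rw [← hx.1, etaQuotient_rX_eq_sq]
  · rw [← hx.2]; exact hy

end Summit.BirchSwinnertonDyer.PrintCf2.TheoremAField

end
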